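import Summits.ResolutionOfSingularities.ResolutionOfSingularities.Theorems.WeightedInvariantSuccessorRatioBoundFrames
import Summits.ResolutionOfSingularities.ResolutionOfSingularities.Theorems.FrobeniusClosingSteerEvenTangentialNormalForm
import HarnessLib

/-!
# (o56)(b′) ring side, PART 4 of 6 — the CHART PULL-BACK of a unit expansion (model-independent): `chart_pullback_expansion`,
# `lowWitness_of_chart`, and the «cylinder-or-deep» form (`chart_pullback_expansion_of_deep`, `lowWitness_of_chart_of_deep`)

**Provenance / honest framing.** This is a VERBATIM PORT (proofs unchanged; namespace `…LocalEngine.Iota3.RatContact` instead of the sketch's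
`…Iota3.R9`) of res-L1-w43-idea-2's kernel-checked sketch `Cruxes/WeightedConstruction/SketchL1w43Idea2R9.lean` (Sketch-R9, gen 9, tree copy
b7197eb188e64d8c = 657de2227c79926d + the §15 unit-factor lemma; §14e as announced f30a0aee35c844fc), board item (o56-R9) of res-L1-w43-plan-1 (dealer word STATUS l.69360), res-plan-2 IDLE POOL
DEAL #52 (2); ported by res-L1-type-o4 so that `Theorems/` files (res-type-057's (D1) bundle for the door item `stmt-ResolutionOfSingularities-19897`
branch (o56)(b′)) can import it; `--supports stmt-ResolutionOfSingularities-0571 --as helper`. [OURS · L1 w43 · idea-2 R9] Every statement here is OURS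
elementary commutative algebra over Mathlib and the tree's `flagContactFiltration` / `weightedMonomialIdeal` / unit-expansion calculus; every `def` is an
OURS notion of the sketch (NOT a statement of H. Hironaka's 2017 manuscript, which is under adjudication and is neither asserted nor used); no Literature
fact is introduced; AI-written and AI-ported, weaker than expert review; nothing here is progress on resolution of singularities in positive characteristic.

## Contents (Sketch-R9 §14, §14b verbatim)
For ANY ring map `φ : S → T` into a regular local ring with `φ x = t`, `φ y = t^b·Y`, `φ(𝔪_S) ⊆ 𝔪_T`, `t ∉ 𝔪_T²`: a unit expansion of `f` mod `𝔪_S^M`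
with the cylinder condition pulls back to a unit expansion of `f₁ = φ(f)/t^(bν)` (`chart_pullback_expansion`; the one-parameter cancellation
`mem_pow_of_mul_mem_pow_succ` is REUSED from the tree's `Theorems.SwitchingDichotomy.EvenTangentialNormalForm`, not restated), an `S`-side `τ = 0` witness becomes the
LOW exponent (`lowWitness_of_chart`, via PART 1 `witness_lands_low`); §14b reads `f` with SCALED weights `(L, L·b, 1)` («cylinder OR deep»).
-/

noncomputable section

open IsLocalRing Literature.AlgebraicGeometry.Resolution

set_option linter.dupNamespace false

namespace Summit.ResolutionOfSingularities.ResolutionOfSingularities.Cruxes.HypersurfaceCentreConstruction.LocalEngine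

namespace Iota3

namespace RatContact

/-! ## §14 (gen 9) The chart pull-back of a unit expansion — door obligation (D1) → `hWit`, model-independently

For ANY ring map `φ : S → T` into a regular local ring with `φ x = t`, `φ y = t^b·Y`, `φ(𝔪_S) ⊆ 𝔪_T`, `t ∉ 𝔪_T²`, a unit expansion
`f ≡ Σ_{α∈Δ} a_α x^{α₀} y^{α₁} z^{α₂} (mod 𝔪_S^M)` whose exponents satisfy the cylinder condition `b·ν ≤ α₀ + b·α₁` (implied by
`δ_η`-preparedness `r(ν − j) ≤ q·i`, `qb ≤ r`) pulls back, after dividing `φ f = t^{bν}·f₁` by `t^{bν}` (order is a valuation in a regular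
local ring: `Literature…mul_not_mem_pow_of_not_mem_pow`), to the expansion `f₁ ≡ Σ φ(a_α)·t^{α₀+bα₁−bν}·(φ z)^{α₂}·Y^{α₁} (mod 𝔪_T^{M−bν})`
in the successor frame `(t, φ z, Y)`.  With `Y := Y' − φ(c)·t` read through the S-frame `(x, y − c·x^{b+1}, z)` (§13) and the exponent
arithmetic `witness_lands_low` (§5) this is the `hWit` clause of `successorRatioBound_of_lowWitnesses`, for every model of the chart. -/

section ChartPullback

variable {S T : Type*} [CommRing S] [IsLocalRing S] [CommRing T] [IsRegularLocalRing T]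

/-- [folklore] Iterated cancellation: `t^n·g ∈ 𝔪^{m+n}` ⇒ `g ∈ 𝔪^m`. -/
theorem mem_pow_of_pow_mul_mem_pow {t : T} (ht2 : t ∉ maximalIdeal T ^ 2) {g : T} {m : ℕ} :
    ∀ n : ℕ, t ^ n * g ∈ maximalIdeal T ^ (m + n) → g ∈ maximalIdeal T ^ m
  | 0, h => by simpa using h
  | n + 1, h => by
    have h' : t * (t ^ n * g) ∈ maximalIdeal T ^ ((m + n) + 1) := by
      rw [← mul_assoc, ← pow_succ']
      simpa [Nat.add_assoc] using h
    exact mem_pow_of_pow_mul_mem_pow ht2 n (Theorems.SwitchingDichotomy.EvenTangentialNormalForm.mem_pow_of_mul_mem_pow_succ ht2 h')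

/-- The successor exponent of `x^{α₀} y^{α₁} z^{α₂}` in the frame `(t, z, Y)` of the `x`-chart of the `(1,b)`-cylinder blow-up. -/
def chartExp (b ν : ℕ) (α : Fin 3 → ℕ) : Fin 3 → ℕ := ![α 0 + b * α 1 - b * ν, α 2, α 1]

/-- First component of `chartExp`. [folklore] -/
@[simp] theorem chartExp_zero (b ν : ℕ) (α : Fin 3 → ℕ) : chartExp b ν α 0 = α 0 + b * α 1 - b * ν := rfl
/-- Second component of `chartExp`. [folklore] -/
@[simp] theorem chartExp_one (b ν : ℕ) (α : Fin 3 → ℕ) : chartExp b ν α 1 = α 2 := rfl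
/-- Third component of `chartExp`. [folklore] -/
@[simp] theorem chartExp_two (b ν : ℕ) (α : Fin 3 → ℕ) : chartExp b ν α 2 = α 1 := rfl

/-- [OURS · L1 w43 · R9 §14] **Chart pull-back of a unit expansion**, any model `φ : S → T` of the `x`-chart. -/
theorem chart_pullback_expansion (φ : S →+* T) {x y z : S} {t Y : T} {b ν M : ℕ} (hx : φ x = t)
    (hy : φ y = t ^ b * Y) (hφ : Ideal.map φ (maximalIdeal S) ≤ maximalIdeal T) (ht2 : t ∉ maximalIdeal T ^ 2)
    {Δ : Finset (Fin 3 → ℕ)} {a : (Fin 3 → ℕ) → S} {f : S} {f₁ : T}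
    (hr : f - ∑ α ∈ Δ, a α * ∏ i, ![x, y, z] i ^ α i ∈ maximalIdeal S ^ M)
    (hcyl : ∀ α ∈ Δ, b * ν ≤ α 0 + b * α 1) (hf₁ : φ f = t ^ (b * ν) * f₁) :
    f₁ - ∑ α ∈ Δ, φ (a α) * ∏ i, ![t, φ z, Y] i ^ chartExp b ν α i ∈ maximalIdeal T ^ (M - b * ν) := by
  have h1 : φ (f - ∑ α ∈ Δ, a α * ∏ i, ![x, y, z] i ^ α i) ∈ maximalIdeal T ^ M := by
    have h := Ideal.mem_map_of_mem φ hr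
    rw [Ideal.map_pow] at h
    exact Ideal.pow_right_mono hφ M h
  have hmono : ∀ α ∈ Δ, φ (a α * ∏ i, ![x, y, z] i ^ α i) =
      t ^ (b * ν) * (φ (a α) * ∏ i, ![t, φ z, Y] i ^ chartExp b ν α i) := by
    intro α hα
    have e : α 0 + b * α 1 = b * ν + (α 0 + b * α 1 - b * ν) := by have := hcyl α hα; omega
    have key : t ^ α 0 * (t ^ b * Y) ^ α 1 = t ^ (b * ν) * t ^ (α 0 + b * α 1 - b * ν) * Y ^ α 1 := by
      rw [mul_pow, ← pow_mul, ← mul_assoc, ← pow_add]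
      conv_lhs => rw [e, pow_add]
    simp only [map_mul, map_pow, Fin.prod_univ_three, Matrix.cons_val_zero, Matrix.cons_val_one,
      Matrix.cons_val_two, Matrix.head_cons, Matrix.tail_cons, hx, hy, chartExp_zero, chartExp_one, chartExp_two]
    rw [key]
    ring
  have h2 : φ (f - ∑ α ∈ Δ, a α * ∏ i, ![x, y, z] i ^ α i) =
      t ^ (b * ν) * (f₁ - ∑ α ∈ Δ, φ (a α) * ∏ i, ![t, φ z, Y] i ^ chartExp b ν α i) := by
    rw [map_sub, map_sum, Finset.sum_congr rfl hmono, ← Finset.mul_sum, hf₁, ← mul_sub]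
  rw [h2] at h1
  by_cases hM : b * ν ≤ M
  · obtain ⟨m, rfl⟩ := Nat.exists_eq_add_of_le hM
    rw [Nat.add_sub_cancel_left]
    exact mem_pow_of_pow_mul_mem_pow ht2 (b * ν) (by rwa [Nat.add_comm] at h1)
  · have h0 : M - b * ν = 0 := by omega
    rw [h0, pow_zero, Ideal.one_eq_top]
    exact Submodule.mem_top

/-- [OURS · L1 w43 · R9 §14] **The `hWit` clause from S-side data.**  Units pull back to units, the remainder order drops by `bν`, and an
S-side `τ = 0` witness `q·α₀ + α₂ < (r+1)(ν − α₁)` of a `δ_η`-prepared exponent (`r(ν−α₁) ≤ q·α₀`) becomes a LOW successor exponent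
`q(e₀ + e₁) < (q+ρ)(ν − e₂)` (`witness_lands_low`, `r = qb + ρ`). -/
theorem lowWitness_of_chart (φ : S →+* T) {x y z : S} {t Y : T} {b ν M q r ρ A : ℕ} (hx : φ x = t)
    (hy : φ y = t ^ b * Y) (hφ : Ideal.map φ (maximalIdeal S) ≤ maximalIdeal T) (ht2 : t ∉ maximalIdeal T ^ 2)
    (hq : 0 < q) (hr : r = q * b + ρ) {Δ : Finset (Fin 3 → ℕ)} {a : (Fin 3 → ℕ) → S} {f : S} {f₁ : T}
    (hunit : ∀ α ∈ Δ, IsUnit (a α))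
    (hrem : f - ∑ α ∈ Δ, a α * ∏ i, ![x, y, z] i ^ α i ∈ maximalIdeal S ^ M) (hM : A * ν + b * ν ≤ M)
    (hcyl : ∀ α ∈ Δ, b * ν ≤ α 0 + b * α 1) (hf₁ : φ f = t ^ (b * ν) * f₁)
    {α₀ : Fin 3 → ℕ} (hα₀ : α₀ ∈ Δ) (hprep₀ : r * (ν - α₀ 1) ≤ q * α₀ 0)
    (hwit₀ : q * α₀ 0 + α₀ 2 < (r + 1) * (ν - α₀ 1)) :
    ∃ (Δ' : Finset (Fin 3 → ℕ)) (c' : (Fin 3 → ℕ) → T) (N : ℕ), (∀ e ∈ Δ', IsUnit (c' e)) ∧ A * ν ≤ N ∧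
      f₁ - ∑ e ∈ Δ', c' e * ∏ i, ![t, φ z, Y] i ^ e i ∈ maximalIdeal T ^ N ∧
      ∃ e ∈ Δ', q * (e 0 + e 1) < (q + ρ) * (ν - e 2) := by
  classical
  -- the inverse re-indexing
  let inv : (Fin 3 → ℕ) → (Fin 3 → ℕ) := fun e => ![e 0 + b * ν - b * e 2, e 2, e 1]
  have hinv : ∀ α ∈ Δ, inv (chartExp b ν α) = α := by
    intro α hα
    have := hcyl α hα
    ext i
    fin_cases i
    · show chartExp b ν α 0 + b * ν - b * chartExp b ν α 2 = α 0
      simp only [chartExp_zero, chartExp_two]; omega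
    · show chartExp b ν α 2 = α 1
      simp
    · show chartExp b ν α 1 = α 2
      simp
  have hinj : Set.InjOn (chartExp b ν) Δ := by
    intro α hα β hβ h
    rw [← hinv α hα, ← hinv β hβ, h]
  refine ⟨Δ.image (chartExp b ν), fun e => φ (a (inv e)), M - b * ν, ?_, ?_, ?_, ?_⟩
  · intro e he
    obtain ⟨α, hα, rfl⟩ := Finset.mem_image.mp he
    show IsUnit (φ (a (inv (chartExp b ν α))))
    rw [hinv α hα]
    exact (hunit α hα).map φ
  · omega
  · have hs : ∑ e ∈ Δ.image (chartExp b ν), φ (a (inv e)) * ∏ i, ![t, φ z, Y] i ^ e i =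
        ∑ α ∈ Δ, φ (a α) * ∏ i, ![t, φ z, Y] i ^ chartExp b ν α i := by
      rw [Finset.sum_image hinj]
      exact Finset.sum_congr rfl (fun α hα => by rw [hinv α hα])
    rw [hs]
    exact chart_pullback_expansion φ hx hy hφ ht2 hrem hcyl hf₁
  · refine ⟨chartExp b ν α₀, Finset.mem_image_of_mem _ hα₀, ?_⟩
    have hν : α₀ 1 ≤ ν := by
      by_contra hlt
      have : ν - α₀ 1 = 0 := by omega
      rw [this] at hwit₀
      simp at hwit₀
    obtain ⟨m, hm⟩ := Nat.exists_eq_add_of_le hν   -- ν = α₀ 1 + m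
    have hqb : q * b ≤ r := by rw [hr]; exact Nat.le_add_right _ _
    have hm' : ν - α₀ 1 = m := by omega
    rw [hm'] at hprep₀ hwit₀
    have hbm : b * m ≤ α₀ 0 := by
      have h1 : q * b * m ≤ r * m := Nat.mul_le_mul_right m hqb
      have h2 : q * (b * m) ≤ q * α₀ 0 := by
        calc q * (b * m) = q * b * m := by ring
          _ ≤ r * m := h1
          _ ≤ q * α₀ 0 := hprep₀
      exact Nat.le_of_mul_le_mul_left h2 hq
    have hw := witness_lands_low (k := α₀ 2) hq hqb hprep₀ hwit₀ hbm
    have hbν : b * ν = b * α₀ 1 + b * m := by rw [hm, mul_add]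
    have e0 : chartExp b ν α₀ 0 = α₀ 0 - b * m := by simp only [chartExp_zero]; omega
    have e2 : ν - chartExp b ν α₀ 2 = m := by simp only [chartExp_two]; omega
    rw [e0, chartExp_one, e2]
    have hρ : r + q - q * b = q + ρ := by rw [hr]; omega
    rw [hρ] at hw
    exact hw

/-! ### §14b The «cylinder-or-deep» form.  A unit expansion of `f` read with SCALED weights `(L, L·b, 1)` at level `L·bν`
(`f ∈ W((x,y,z);(1,b,0);bν) ⊆ W((x,y,z);(L,Lb,1);Lbν)`, `weightedMonomialIdeal_mono_weights` + the tree reading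
`Theorems.LocalGameEFTNewton.le_weight_of_mem_weightedMonomialIdeal`, positive weights) only yields, per exponent, «cylinder condition
OR `z`-degree `≥ L`» (`le_or_le_of_scaled`); the deep terms are swallowed by the remainder (`z ∈ 𝔪_S`), so the chart pull-back goes
through on the cylinder part of `Δ`.  The same scaling reads `δ_η`-preparedness of the (shallow) `τ`-witness. -/

/-- [folklore] Unscaling a scaled weight inequality: `L·n ≤ L·s + k` ⇒ `n ≤ s` or `k ≥ L`. -/
theorem le_or_le_of_scaled {L n s k : ℕ} (h : L * n ≤ L * s + k) : n ≤ s ∨ L ≤ k := by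
  by_cases hk : L ≤ k
  · exact Or.inr hk
  · left
    have hlt : L * n < L * (s + 1) := by
      rw [Nat.mul_succ]
      exact lt_of_le_of_lt h (Nat.add_lt_add_left (Nat.lt_of_not_le hk) _)
    exact Nat.lt_succ_iff.mp (Nat.lt_of_mul_lt_mul_left hlt)

/-- [folklore] Monotonicity of the weighted filtration in the weights: `L·wᵢ ≤ w'ᵢ` for all `i` ⇒ `W(u;w;n) ⊆ W(u;w';L·n)`. -/
theorem weightedMonomialIdeal_mono_weights {A : Type*} [CommRing A] {m : ℕ} (u : Fin m → A) {w w' : Fin m → ℕ}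
    {L : ℕ} (h : ∀ i, L * w i ≤ w' i) (n : ℕ) :
    weightedMonomialIdeal u w n ≤ weightedMonomialIdeal u w' (L * n) := by
  apply Ideal.span_le.mpr
  rintro _ ⟨α, hα, rfl⟩
  refine Theorems.prod_pow_mem_weightedMonomialIdeal u w' α ?_
  calc L * n ≤ L * ∑ i, w i * α i := Nat.mul_le_mul_left L hα
    _ = ∑ i, L * w i * α i := by rw [Finset.mul_sum]; simp [mul_assoc]
    _ ≤ ∑ i, w' i * α i := Finset.sum_le_sum (fun i _ => Nat.mul_le_mul_right _ (h i))

/-- [OURS · L1 w43 · R9 §14b] Chart pull-back, cylinder-or-deep form. -/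
theorem chart_pullback_expansion_of_deep (φ : S →+* T) {x y z : S} {t Y : T} {b ν M : ℕ} (hx : φ x = t)
    (hy : φ y = t ^ b * Y) (hφ : Ideal.map φ (maximalIdeal S) ≤ maximalIdeal T) (ht2 : t ∉ maximalIdeal T ^ 2)
    (hz : z ∈ maximalIdeal S) {Δ : Finset (Fin 3 → ℕ)} {a : (Fin 3 → ℕ) → S} {f : S} {f₁ : T}
    (hr : f - ∑ α ∈ Δ, a α * ∏ i, ![x, y, z] i ^ α i ∈ maximalIdeal S ^ M)
    (hcyl : ∀ α ∈ Δ, b * ν ≤ α 0 + b * α 1 ∨ M ≤ α 2) (hf₁ : φ f = t ^ (b * ν) * f₁) :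
    f₁ - ∑ α ∈ Δ.filter (fun α => b * ν ≤ α 0 + b * α 1), φ (a α) * ∏ i, ![t, φ z, Y] i ^ chartExp b ν α i ∈
      maximalIdeal T ^ (M - b * ν) := by
  classical
  have hbad : ∑ α ∈ Δ.filter (fun α => ¬ b * ν ≤ α 0 + b * α 1), a α * ∏ i, ![x, y, z] i ^ α i ∈
      maximalIdeal S ^ M := by
    refine Ideal.sum_mem _ (fun α hα => ?_)
    obtain ⟨hαΔ, hnot⟩ := Finset.mem_filter.mp hα
    have hdeep : M ≤ α 2 := (hcyl α hαΔ).resolve_left hnot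
    refine Ideal.mul_mem_left _ _ ?_
    rw [Fin.prod_univ_three]
    simp only [Matrix.cons_val_zero, Matrix.cons_val_one, Matrix.cons_val_two, Matrix.head_cons, Matrix.tail_cons]
    exact Ideal.mul_mem_left _ _ (Ideal.pow_le_pow_right hdeep (Ideal.pow_mem_pow hz _))
  have hr' : f - ∑ α ∈ Δ.filter (fun α => b * ν ≤ α 0 + b * α 1), a α * ∏ i, ![x, y, z] i ^ α i ∈
      maximalIdeal S ^ M := by
    have hsplit := Finset.sum_filter_add_sum_filter_not Δ (fun α => b * ν ≤ α 0 + b * α 1)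
      (fun α => a α * ∏ i, ![x, y, z] i ^ α i)
    have h := Ideal.add_mem _ hr hbad
    rw [← hsplit] at h
    convert h using 1
    ring
  exact chart_pullback_expansion φ hx hy hφ ht2 hr' (fun α hα => (Finset.mem_filter.mp hα).2) hf₁

/-- [OURS · L1 w43 · R9 §14b] The `hWit` clause, cylinder-or-deep form (the shallow `τ`-witness is automatically on the cylinder side). -/
theorem lowWitness_of_chart_of_deep (φ : S →+* T) {x y z : S} {t Y : T} {b ν M q r ρ A : ℕ} (hx : φ x = t)
    (hy : φ y = t ^ b * Y) (hφ : Ideal.map φ (maximalIdeal S) ≤ maximalIdeal T) (ht2 : t ∉ maximalIdeal T ^ 2)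
    (hz : z ∈ maximalIdeal S) (hq : 0 < q) (hr : r = q * b + ρ) {Δ : Finset (Fin 3 → ℕ)} {a : (Fin 3 → ℕ) → S}
    {f : S} {f₁ : T} (hunit : ∀ α ∈ Δ, IsUnit (a α))
    (hrem : f - ∑ α ∈ Δ, a α * ∏ i, ![x, y, z] i ^ α i ∈ maximalIdeal S ^ M) (hM : A * ν + b * ν ≤ M)
    (hcyl : ∀ α ∈ Δ, b * ν ≤ α 0 + b * α 1 ∨ M ≤ α 2) (hf₁ : φ f = t ^ (b * ν) * f₁)
    {α₀ : Fin 3 → ℕ} (hα₀ : α₀ ∈ Δ) (hprep₀ : r * (ν - α₀ 1) ≤ q * α₀ 0)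
    (hwit₀ : q * α₀ 0 + α₀ 2 < (r + 1) * (ν - α₀ 1)) :
    ∃ (Δ' : Finset (Fin 3 → ℕ)) (c' : (Fin 3 → ℕ) → T) (N : ℕ), (∀ e ∈ Δ', IsUnit (c' e)) ∧ A * ν ≤ N ∧
      f₁ - ∑ e ∈ Δ', c' e * ∏ i, ![t, φ z, Y] i ^ e i ∈ maximalIdeal T ^ N ∧
      ∃ e ∈ Δ', q * (e 0 + e 1) < (q + ρ) * (ν - e 2) := by
  classical
  -- the S-side remainder absorbs the deep terms
  have hbad : ∑ α ∈ Δ.filter (fun α => ¬ b * ν ≤ α 0 + b * α 1), a α * ∏ i, ![x, y, z] i ^ α i ∈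
      maximalIdeal S ^ M := by
    refine Ideal.sum_mem _ (fun α hα => ?_)
    obtain ⟨hαΔ, hnot⟩ := Finset.mem_filter.mp hα
    have hdeep : M ≤ α 2 := (hcyl α hαΔ).resolve_left hnot
    refine Ideal.mul_mem_left _ _ ?_
    rw [Fin.prod_univ_three]
    simp only [Matrix.cons_val_zero, Matrix.cons_val_one, Matrix.cons_val_two, Matrix.head_cons, Matrix.tail_cons]
    exact Ideal.mul_mem_left _ _ (Ideal.pow_le_pow_right hdeep (Ideal.pow_mem_pow hz _))
  have hr' : f - ∑ α ∈ Δ.filter (fun α => b * ν ≤ α 0 + b * α 1), a α * ∏ i, ![x, y, z] i ^ α i ∈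
      maximalIdeal S ^ M := by
    have hsplit := Finset.sum_filter_add_sum_filter_not Δ (fun α => b * ν ≤ α 0 + b * α 1)
      (fun α => a α * ∏ i, ![x, y, z] i ^ α i)
    have h := Ideal.add_mem _ hrem hbad
    rw [← hsplit] at h
    convert h using 1
    ring
  -- the witness is shallow: preparedness puts it on the cylinder side
  have hcyl₀ : b * ν ≤ α₀ 0 + b * α₀ 1 := by
    have hν : α₀ 1 ≤ ν := by
      by_contra hlt
      have : ν - α₀ 1 = 0 := by omega
      rw [this] at hwit₀
      simp at hwit₀
    obtain ⟨m, hm⟩ := Nat.exists_eq_add_of_le hν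
    have hm' : ν - α₀ 1 = m := by omega
    rw [hm'] at hprep₀
    have hqb : q * b ≤ r := by rw [hr]; exact Nat.le_add_right _ _
    have h2 : q * (b * m) ≤ q * α₀ 0 :=
      calc q * (b * m) = q * b * m := by ring
        _ ≤ r * m := Nat.mul_le_mul_right m hqb
        _ ≤ q * α₀ 0 := hprep₀
    have hbm : b * m ≤ α₀ 0 := Nat.le_of_mul_le_mul_left h2 hq
    have hbν : b * ν = b * α₀ 1 + b * m := by rw [hm, mul_add]
    omega
  exact lowWitness_of_chart φ hx hy hφ ht2 hq hr (fun α hα => hunit α (Finset.mem_filter.mp hα).1) hr' hM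
    (fun α hα => (Finset.mem_filter.mp hα).2) hf₁ (Finset.mem_filter.mpr ⟨hα₀, hcyl₀⟩) hprep₀ hwit₀

end ChartPullback

end RatContact

end Iota3

end Summit.ResolutionOfSingularities.ResolutionOfSingularities.Cruxes.HypersurfaceCentreConstruction.LocalEngine
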